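import Literature.MathematicalPhysics.QuantumFieldTheory.Balaban1983to89.B8SectGH
import Literature.MathematicalPhysics.QuantumFieldTheory.Balaban1983to89.B8ScaledSupNorm
import Literature.MathematicalPhysics.QuantumFieldTheory.Balaban1983to89.B8Thm8TorusWitness

/-!
# Bałaban CMP 99 (1985) 75–102 [B8], Theorem 8 (p. 101) AS PRINTED fails in the flat abelian chart model:
# `¬ B8SectGH.Thm8PrintedAt 1 B₁ B₂ fam` for every `B₁, B₂` (cell objection GAPS G-B8-13, print side, kernel-checked)

statement-level skeleton of published theorems with citation tags; proofs where landed; nothing here is a claim about the Yang–Mills mass gap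

Bałaban, T.: "Spaces of regular gauge field configurations on a lattice and gauge fixing conditions", Commun. Math.
Phys. 99 (1985) 75–102 [cite: Balaban1985RegularSpaces] (B8; PDF page = journal page − 74); [4] = Bałaban, T.:
"Propagators for lattice gauge theories in a background field", Commun. Math. Phys. 99 (1985) 389–434
[cite: Balaban1985BackgroundPropagators]; [3] = Bałaban, T.: "Averaging operations for lattice gauge theories",
Commun. Math. Phys. 98 (1985) 17–51 [cite: Balaban1985Averaging].

WHAT IS PRINTED (Theorem 8, p. 101, verbatim; typed faithfully as `B8SectGH.Thm8PrintedAt γ B₁ B₂ fam`, "e.g. γ = 1"):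
"There exist constants B₁, B₂(β₀), c₁ such that for arbitrary U₀, U′U₀ satisfying (1.33)–(1.35) with α₀ + α₁ ≤ c₁,
and for an arbitrary function f from the space R(U₀) satisfying the bound |f|₍₋₂₎ < γ(α₀ + α₁), there exists exactly
one gauge transformation u satisfying (1.29) and such, that the conditions (1.36), (1.37), (1.39), and (1.146) hold
for the configuration U₁ = U′^{u⁻¹}.  The constants B₁, B₂(β₀) are as in Theorems 2, 4, the constant c₁ depends on
d, L and γ."  Its printed proof is the preceding sentence: "Inspecting the proofs of the theorems and propositions
we can see easily that they work in this more general situation almost without any changes, only some constants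
change their numerical values."  On the constants (p. 83, verbatim): "Of course we want to prove that the constants
B₁, B₂(β₀) in (1.36), (1.39) are absolute constants depending on d and L only, B₂(β₀) on β₀ also."

THE OBJECTION (GAPS G-B8-13, OWNER ADJUDICATION lit-balaban r05 2026-08-22; print-side reading `B8.Thm8Inspected`,
model side `B8Thm8TorusWitness`).  The inspection route (p. 86, (1.57)–(1.58) with (1.146) replacing the first equation
of (1.42)) puts the term G(U₀)D^η_{U₀}f into A, and [4] controls sup|∇_U G′∇*_U f| only by (3.44) p. 398 (Hölder norm of
the source, constant B′₀(ε) → ∞), not by |f|₍₋₂₎ ((3.42) p. 397 lists G′, ∇G′, G′∇*, ΔG′ only).  In the simplest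
instance — U₀ = 1, abelian group, U′ = 1, all domains Ω_j = T_η (admitted, p. 77) — the theorem's (1.29)-restricted
u with (1.146) is FORCED (u = e^{iλ}, λ = Δ⁻¹f on N(Q′)), and for f = Δλ₀ with the block-mean-zero bump λ₀ of
`B8Thm8TorusWitness` its ∇A = Hess λ₀ exceeds any K-uniform multiple of |f|₍₋₂₎ ((K − 1)·log L − 5/2 → ∞, ε = L^{−K}).

WHAT IS PROVED HERE (0 sorry; the model and its packaging are OUR construction; the refuted sentence is the tree's
faithful typing of the printed theorem).
 * §1 the flat abelian chart model on a torus of record `Site P 0` with the `B1RG242Torus` operators: bond fields,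
   `grad` = D^η_1 λ, `div` = D^{η*}_1 A (`div_grad`: D*Dλ = Δλ = `H P 0` λ, [4] (3.23)), `InN` = N(Q′_K) ((1.29)/(1.5) for
   the constant sequence: only Λ_k = T₁ is constrained), `InRange` = ΔN(Q′) = range of R(1) ([4] (3.21)), `ProjEq g f` =
   "R(1)g = f" (f in the range, g − f orthogonal to it), `norm2` = |·|₍₋₂₎ (`B8ScaledSupNorm.msup`, p. 86);
   `eq_of_projEq`: λ, λ′ ∈ N(Q′), R(1)Δλ = Δλ′ ⇒ λ = λ′ (`B1RG242Torus.eq_zero_of_ker`); `norm2_le` (weights ≤ 1).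
 * §2 `flatGF P : B8SectGH.GFData3`, the packaging (field-by-field reading in its docstring): HYPOTHESIS fields equal
   to or stronger than print (`InAAx`, `avgClose` pin U′ = 1, which satisfies (1.34)–(1.35)), CONCLUSION fields read by
   the sentence equal to or weaker than print (`Restricted` = (1.29) in the chart, `act` = U′^{u⁻¹} in the chart, `C136`
   = the |A|- and ∇-members of (1.36) at the top level j = k only, `LandauF` = (1.146) verbatim, `C137` = `C139` =
   True).  Consequently THE PRINTED THEOREM, read on this model, IMPLIES the EXISTENCE half of the packaged sentence;
   the packaged uniqueness clause is formally stronger than print's (it omits (1.37), (1.39) from the competitor's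
   properties) but is never used: the refutation goes through existence alone (`no_restricted_landau_solution`).
 * §3 `no_restricted_landau_solution`: for f = Δ^ε_1(s·λ₀), s > 0, every restricted λ with (1.146) for U′ = 1 equals
   s·λ₀, so the top-level ∇-member of (1.36) fails for every B ≤ s·((K − 1)·log L − 5/2).
 * §4 `not_thm8PrintedAt P hd B₁ B₂ : ¬ Thm8PrintedAt 1 B₁ B₂ (fun K ↦ flatGF (withK P K))` for every torus-of-record
   template P with d ≥ 2 (family index K = number of RG steps; d, L, m fixed), and the corollaries `not_thm8PrintedR`,
   `not_thm8Printed` (r1's `B8.Thm8Printed`) via `B8SectGH.thm8PrintedAt_one_of_R` / `thm8PrintedAt_one_of_printed`.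
   The choice inside: K with (K − 1)·log L − 5/2 > 4B₁, α₀ = α₁ = c₁/2, s = c₁/4 (so |f|₍₋₂₎ ≤ 2s < α₀ + α₁ and
   B₁(α₀ + α₁) = 4B₁s < s·((K − 1)·log L − 5/2)).

HONEST SCOPE.  (a) WHAT IS REFUTED is the sentence of Theorem 8 with "B₁ as in Theorems 2, 4" (K-uniform) and the
hypothesis |f|₍₋₂₎ < γ(α₀ + α₁) ALONE, in ONE admitted instance; what fails is the ∇-member of (1.36) (a fortiori the
Hölder member).  NOT refuted, and typed as surviving: the |A|-member, (1.37), (1.146), uniqueness, and all of (1.36) +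
(1.39) under the ADDED hypothesis |D^η_{U₀}f|₍₋₃₎ < γ(α₀ + α₁) (`B8.Thm8Inspected`, `B8.thm8_exists_of_printed`,
`B8SectDSource.thm8_sectD_inspected`); the series' consumer (CMP 102 (1985) p. 297, (125)) uses only the surviving part
(pub-balaban GAPS G-B11-E3a) — nothing downstream moves.  (b) ONE γ: γ = 1 ("e.g. γ = 1", p. 101); by
`B8SectGH.thm8PrintedAt_anti` every γ ≥ 1 fails too, and the proof is scale-free in γ (replace 4B₁ by 4B₁/γ) — not
spelled out.  (c) THE INSTANCE IS ADMITTED: p. 77 "we admit the case where some domains Ω_j are equal to T_η, for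
example Ω_j = T_η for j = 0, 1, …, l, l ≤ k" with l = k; U₀ = 1 satisfies (1.33) ((1.7), (1.9), and (3.35) of [4] with
u = 1, A = 0); U′ = 1 satisfies (1.34) (1 ∈ 𝔄_k; the axial gauge Ax_k(𝔅_k, 1) of (1.19) consists of equations between
averages of the configuration all of which hold at the unit configuration) and (1.35) (both averages equal 1̄ = 1);
the abelian group U(1) (Lie algebra ℝ) is a compact Lie group as in the series' standing setting — the paper does
not exclude it, and the mechanism (a missing sup-norm estimate for ∇G∇*) is group-independent.  (d) FINITE TORI OF
RECORD: `Site P 0` has 2L^{m+K} sites per direction (B12 (0.1) normalisation of `Setup`), L odd > 1, K ≥ 2, d ≥ 2, m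
arbitrary; the refuting family varies K only (`withK`), exactly the uniformity print claims (ε = L^{−K} → 0).
(e) THE SCALAR PRODUCT behind "orthogonal projection" is the flat one with equal site weights ((1.5) of B1 / L²(Ω₀, g)
of [4] (3.21) up to the constant factor η^d, which does not change orthogonality); D^{η*} is the transpose of D^η
accordingly (`B1RG242Torus` NOT-CERTIFIED (vii)).  (f) NORMS: |f|₍₋₂₎ is print's p. 86 double supremum
(`B8ScaledSupNorm.msup`, real `iSup`), here over Ω_j = T_η, j ≤ k = K, weights (L^jε)² ≤ 1; only the upper bound
|f|₍₋₂₎ ≤ sup|f| is used.  (g) EXPONENTIAL CHART (the one modelling decision to be aware of): `GT` is the Lie algebra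
(site functions λ, u = e^{iλ}), (1.29) is read as Q′_K λ = 0 and U′^{u⁻¹} as A′ + D^ηλ.  For the abelian group these
readings are EXACT whenever all differences λ(x) − λ(y) inside a block and along bonds lie in (−π, π) (the one-step
averages (78) of [3] are exp-mean-arg, and p. 80: "for u(x) = e^{iλ(x)} and λ small a linear part of the function
(1/i) log(R₀u^j)(y) is equal to (Q′_j(U₀)λ)(y)"); print's own construction (Sects. D–E, Prop. 5: u = e^{iλ} with |λ|,
|Dλ|₍₋₁₎ small) lives in the chart.  A U(1)-valued restricted u OUTSIDE the chart (large relative phases / windings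
around the torus) is not excluded by this file; the referee-checkable argument that none satisfies the theorem's
conclusions once α₀ + α₁ < π/(dL^m B₁) — U₁ = U′^{u⁻¹} is a pure gauge, so its plaquette holonomies are 1 and
so are its holonomies around the d cycles of the torus; the |A|-member of (1.36) gives |ηA| < ηB₁(α₀ + α₁) on every
bond, hence the plaquette sums of ηA vanish (|·| < 4ηB₁(α₀ + α₁) < 2π) and the cycle sums, which lie in 2πℤ and are
bounded by 2L^{m+K}·η·B₁(α₀ + α₁) = 2L^m B₁(α₀ + α₁) < 2π, vanish too; so ηA is the exact gradient of a real lift λ of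
u (u = e^{iλ}) with |λ(x) − λ(y)| < d·B₁(α₀ + α₁) < π inside every block, whence every one-step average (78) is
exp(i·mean) exactly, (R₀ū^k)(y) = exp(i(Q_kλ)(y)), and (1.29) gives Q_kλ ∈ 2πℤ, constant over the connected unit
lattice, = 0 after shifting λ by a constant: u is in the chart with Q′_Kλ = 0 and A = D^ηλ — is NOT kernel-checked
here (successor file: the U(1)-valued model via `Real.Angle` with this lifting lemma).  (h) No claim about the Yang–Mills programme or the mass gap is made or
implied; the value is a kernel certificate behind an erratum-type remark on one clause of one theorem whose
downstream use does not involve that clause.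

CELL BOOK-KEEPING (lit-balaban r05 gen 17).  ROWS-B8 row B8.Thm8; B8-CLOSURE.md §5 item 1b; GAPS G-B8-13 OWNER
ADJUDICATION (E2 print side).  VALUE = kernel certificate, NOT summit progress.
v1.1 (docstring only): the page-1 honest-framing sentence added (referee ref-2 gen 53, N1 framing check); no declaration changed.
-/

noncomputable section

open scoped BigOperators
open Matrix Finset

namespace Literature.MathematicalPhysics.QuantumFieldTheory.Balaban1983to89.B8Thm8FlatAbelianFamily

open B1RG242Torus (Qk H hOp avgMat hOp_mulVec eq_zero_of_ker lvl)
open B8Thm8TorusWitness (dir0 dir1 lam0 ctr withK Qk_lam0 abs_H_zero_lam0_le deriv_deriv_lam0_ctr)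
open B8ScaledSupNorm (msup msup_le weight weight_neg_natCast weight_nonneg)

variable (P : Params)

/-! ## §1 The flat abelian model on one torus of record `T_ε = Site P 0` (U₀ = 1, exponential chart) -/

/-- Bond fields on `T_ε`: `A μ x` = the value on the bond `⟨x, x + εe_μ⟩` (a Lie-algebra (= ℝ, abelian) valued vector
field; `U₁ = e^{iηA}`, p. 82). [folklore] -/
abbrev BondField : Type := Fin P.d → Site P 0 → ℝ

/-- `D^η_{U₀} λ` at `U₀ = 1`: the forward derivatives (B1 (1.4), `B1RG242Torus.deriv`) of a site function — the
linearisation (exact in the abelian chart) of `u ↦ U′^{u⁻¹}` at `U′ = 1`, `u = e^{iλ}`. [cite: Balaban1982Higgs1, (1.4) p.604] -/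
def grad (lam : Site P 0 → ℝ) : BondField P := fun μ => B1RG242Torus.deriv P 0 P.eps μ *ᵥ lam

/-- `D^{η*}_{U₀} A` at `U₀ = 1`: `Σ_μ (∂^ε_μ)ᵀ A_μ` (the (1.5)-adjoint is the transpose for equal weights,
`B1RG242Torus` NOT-CERTIFIED (vii)). [cite: Balaban1982Higgs1, (1.4)–(1.5) p.604] -/
def div (A : BondField P) : Site P 0 → ℝ := ∑ μ, (B1RG242Torus.deriv P 0 P.eps μ)ᵀ *ᵥ A μ

/-- `λ ∈ N(Q′(U₀))` (p. 80: "N(Q′(U₀)) = {λ : Q′(U₀)λ = 0}") at `U₀ = 1` for the CONSTANT domain sequence `Ω_j = T_η`,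
`j = 0, …, k` (admitted on p. 77: "we admit the case where some domains Ω_j are equal to T_η, for example Ω_j = T_η for
j = 0, 1, …, l, l ≤ k"), for which (1.5) gives `Λ_j = ∅` (`j < k`), `Λ_k = T₁^{(k)}`: the only averages constrained are
the `k`-fold block means, `Q′_k(1) = B1RG242Torus.Qk P K`.  This is also the chart reading of (1.29)
"(R₀ū^j)(y) = 1 for y ∈ Λ_j" for `u = e^{iλ}` (p. 80: "for u(x) = e^{iλ(x)} and λ small a linear part of the function
(1/i) log(R₀u^j)(y) is equal to (Q′_j(U₀)λ)(y)"; exact for the abelian group inside the chart, HONEST SCOPE (g)).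
[cite: Balaban1985RegularSpaces, p.80 + (1.29) p.81 + (1.5) p.77] -/
def InN (lam : Site P 0 → ℝ) : Prop := Qk P P.K *ᵥ lam = 0

/-- `f ∈ Δ^η_{U₀} N(Q′)` = the range of the projection `R(U₀)` ([4] (3.21) p. 394: "R = R(U) is an orthogonal projection
in the Hilbert space L²(Ω₀, g) onto the subspace ℛ = Δ^η_U N(Q′), N(Q′) = {λ : Q′λ = 0}"; (3.23): "Δ^η_U = D^{η*}_U D^η_U")
at `U₀ = 1`: print's hypothesis "f from the space R(U₀), i.e. … satisfying R(U₀)f = f" (p. 101).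
[cite: Balaban1985BackgroundPropagators, (3.21)–(3.23) p.394] [cite: Balaban1985RegularSpaces, (1.146) p.101] -/
def InRange (f : Site P 0 → ℝ) : Prop := ∃ lam : Site P 0 → ℝ, InN P lam ∧ H P 0 *ᵥ lam = f

/-- "`R(U₀) g = f`" at `U₀ = 1`: `f` lies in the range `Δ N(Q′)` of the orthogonal projection `R(1)` and `g − f` is
orthogonal to it (the (1.5) scalar product with equal weights = `dotProduct` up to the factor `ε^d`).  With
`g = D^{η*}A` this is (1.146) "R(U₀)D^{η*}_{U₀}A = f" (and (1.38) for `f = 0`).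
[cite: Balaban1985RegularSpaces, (1.146) p.101 + (1.38) p.82] [cite: Balaban1985BackgroundPropagators, (3.21) p.394] -/
def ProjEq (g f : Site P 0 → ℝ) : Prop :=
  InRange P f ∧ ∀ mu : Site P 0 → ℝ, InN P mu → (g - f) ⬝ᵥ (H P 0 *ᵥ mu) = 0

/-- `|f|₍₋₂₎ = sup_j sup_{Ω_j} (L^jη)²|f|` (p. 86, `B8ScaledSupNorm.msup`) for the constant sequence `Ω_j = T_η`,
`j ≤ k = K`, `η = ε`. [cite: Balaban1985RegularSpaces, p.86 (definition after (1.55)) + Thm 8 p.101] -/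
def norm2 (f : Site P 0 → ℝ) : ℝ := msup P.L P.K P.eps (-2) (fun (_ : ℕ) (_ : Site P 0) => True) f

/-- `|D^η_{U₀} f|₍₋₃₎` at `U₀ = 1` for the constant sequence (the cell's added hypothesis `B8.GFData2.fGrad`; not read by
Theorem 8's sentence). [cite: Balaban1985RegularSpaces, p.86 (definition after (1.55))] -/
def gradNorm3 (f : Site P 0 → ℝ) : ℝ :=
  msup P.L P.K P.eps (-3) (fun (_ : ℕ) (_ : Fin P.d × Site P 0) => True) (fun p => grad P f p.1 p.2)

variable {P}

/-- `D^{η*}_1 D^η_1 λ = Δ^η_1 λ = H P 0 λ` ([4] (3.23) at U = 1). [cite: Balaban1985BackgroundPropagators, (3.23) p.394] -/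
theorem div_grad (lam : Site P 0 → ℝ) : div P (grad P lam) = H P 0 *ᵥ lam := by
  unfold div grad
  rw [B1RG242Torus.H, hOp_mulVec, zero_smul, zero_add]

/-- `N(Q′)` is closed under subtraction. [cite: Balaban1985RegularSpaces, p.80] -/
theorem InN.sub {lam lam' : Site P 0 → ℝ} (h : InN P lam) (h' : InN P lam') : InN P (lam - lam') := by
  unfold InN at *
  rw [Matrix.mulVec_sub, h, h', sub_zero]

/-- `N(Q′)` is closed under scalars. [cite: Balaban1985RegularSpaces, p.80] -/
theorem InN.smul {lam : Site P 0 → ℝ} (c : ℝ) (h : InN P lam) : InN P (c • lam) := by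
  unfold InN at *
  rw [Matrix.mulVec_smul, h, smul_zero]

/-- **`R(1)` is injective on `Δ N(Q′)` and `Δ` is injective on `N(Q′)`**: if `λ, λ′ ∈ N(Q′_K)` and `R(1)(Δλ) = Δλ′` then
`λ = λ′` — from `(Δ(λ − λ′), Δ(λ − λ′)) = 0` and the kernel lemma `B1RG242Torus.eq_zero_of_ker` (Δw = 0, Q_K w = 0 ⇒
w = 0; B1 Prop. 2.3 / B5 p. 39 for U = 1).  This is the uniqueness half of the variational characterisation [4] (3.22)
in the flat case. [cite: Balaban1985BackgroundPropagators, (3.21)–(3.22) p.394] -/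
theorem eq_of_projEq {lam lam' : Site P 0 → ℝ} (h : InN P lam) (h' : InN P lam')
    (hp : ProjEq P (H P 0 *ᵥ lam) (H P 0 *ᵥ lam')) : lam = lam' := by
  have hw : InN P (lam - lam') := InN.sub h h'
  have h0 := hp.2 (lam - lam') hw
  rw [← Matrix.mulVec_sub] at h0
  have hH : H P 0 *ᵥ (lam - lam') = 0 := dotProduct_self_eq_zero.mp h0
  have hwpos : (0 : ℝ) < (((P.L : ℝ) ^ P.d)⁻¹) ^ lvl P P.K := pow_pos (inv_pos.mpr (pow_pos P.cast_L_pos _)) _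
  have := eq_zero_of_ker (i' := P.K) (a := lvl P P.K) P.eps_pos.ne' le_rfl hwpos (lam - lam') hH hw
  exact sub_eq_zero.mp this

/-- The weights `(L^jε)²`, `j ≤ K`, of `|·|₍₋₂₎` on `T_ε` are `≤ 1` (`L^jε = L^{j−K}`). [cite: Balaban1985RegularSpaces, p.86 (definition after (1.55))] -/
theorem weight_le_one {j : ℕ} (hj : j ≤ P.K) : weight P.L P.eps (-2) j ≤ 1 := by
  rw [show (-2 : ℝ) = -((2 : ℕ) : ℝ) by norm_num, weight_neg_natCast]
  have hL1 : (1 : ℝ) ≤ P.L := by exact_mod_cast P.L_pos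
  have h0 : 0 ≤ (P.L : ℝ) ^ j * P.eps := mul_nonneg (pow_nonneg P.cast_L_pos.le _) P.eps_pos.le
  have h1 : (P.L : ℝ) ^ j * P.eps ≤ 1 := by
    unfold Params.eps
    rw [inv_pow, ← div_eq_mul_inv, div_le_one (pow_pos P.cast_L_pos _)]
    exact pow_le_pow_right₀ hL1 hj
  exact pow_le_one₀ h0 h1

/-- A pointwise bound `|f| ≤ c` on `T_ε` bounds `|f|₍₋₂₎ ≤ c` (constant sequence). [cite: Balaban1985RegularSpaces, p.86 (definition after (1.55))] -/
theorem norm2_le {f : Site P 0 → ℝ} {c : ℝ} (hc : 0 ≤ c) (h : ∀ x, |f x| ≤ c) : norm2 P f ≤ c := by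
  apply msup_le hc
  intro j hj x _
  have hw := weight_le_one (P := P) hj
  have hw0 : 0 ≤ weight P.L P.eps (-2) j := weight_nonneg _ P.eps_pos.le _ _
  calc weight P.L P.eps (-2) j * ‖f x‖ ≤ 1 * ‖f x‖ := by gcongr
    _ = |f x| := by rw [one_mul, Real.norm_eq_abs]
    _ ≤ c := h x

variable (P)

/-! ## §2 The flat abelian family packaged as `B8SectGH.GFData3` -/

/-- **The flat abelian chart model of Theorem 8 on the torus of record `P`, packaged as pv17's `B8SectGH.GFData3`.**
Backgrounds `Cfg = {U₀ = 1}`; perturbations `Pert` = bond fields `A′` (`U′ = e^{iηA′}`); gauge transformations `GT` =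
site functions `λ` (`u = e^{iλ}`, the exponential chart); sources `Src` = site functions; `k = K`; constant domain
sequence `Ω_j = T_η` (p. 77), so `Λ_j = ∅` (`j < k`), `Λ_k = T₁` ((1.5)).  HYPOTHESIS fields (equal to or STRONGER than
print, so that the printed theorem implies the packaged sentence): `InA α₀ 1` = (1.33)₁ "U₀ ∈ 𝔄_k({Ω_j}, α₀)", which for
`U₀ = 1` ((1.7)/(1.9): `|U₀(∂p) − 1| = 0`, `∇U₀ = 0`) reads `0 < α₀`; `Reg335 α₀ 1` = "(3.35) of [4]" (p. 396: on every cube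
"there exists a gauge transformation u on □ such that U^u = e^{iηA} … |A| < O(1)Mα₀(L^jη)^{−1}, |∇^η_U A| <
O(1)Mα₀(L^jη)^{−2}", met by `u = 1, A = 0`) reads `0 < α₀`; `InAAx α₀ 1 A′ := (A′ = 0 ∧ 0 < α₀)` and `avgClose α₁ 1 A′ :=
(A′ = 0 ∧ 0 < α₁)` RESTRICT the packaged sentence to the single perturbation `U′ = 1`, which satisfies (1.34)
(`1 ∈ 𝔄_k`, and `1 ∈ Ax_k(𝔅_k, 1)`: the axial-gauge conditions (1.19) are equations `R(…) = 1` between averages of the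
field, all equal to `1` at the unit configuration) and (1.35) (`|(U′U₀)‾ʲ − Ū₀ʲ| = |1 − 1| = 0 < α₁`); `InR 1 f` =
"f ∈ R(U₀)" = `InRange`; `fNorm` = `|f|₍₋₂₎` = `norm2`.  CONCLUSION fields read by the sentence (equal to or WEAKER
than print): `Restricted 1 λ` = (1.29) in the chart = `InN` (`Q′_K λ = 0`); `act A′ λ = A′ + D^η λ` (`U′^{u⁻¹} =
e^{iη(A′ + D^ηλ)}` for the abelian group); `C136 B₁ B₂ s 1 A` = the first two members of (1.36) AT THE TOP LEVEL `j = k`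
ONLY (weight `(L^kη)^{−1} = (L^kη)^{−2} = 1`): `|A_μ(x)| < B₁s` and `|(∇^η A)_{μν}(x)| = |(∂^ε_μ A_ν)(x)| < B₁s` at every
site — weaker than (1.36) (all levels, all components, plus the Hölder member); `LandauF 1 f A` = (1.146)
`R(1)D^{η*}A = f` = `ProjEq (div A) f`; `C137`, `C139` := `True` (weaker; see `no_restricted_landau_solution` for why
the uniqueness clause plays no role).  Fields NOT read by Theorem 8's sentence: `Landau` = (1.38) (faithful),
`C162 B s` = `|A| < Bs` at the top level, `avgClose166` as `avgClose`, `fGrad` = `|D^ηf|₍₋₃₎`, `InAPair`, `C140` := `True`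
(Prop. 3 / Prop. 7 hypotheses, not modelled). [cite: Balaban1985RegularSpaces, (1.29) p.81 + (1.33)–(1.39) pp.82–83 + (1.146) p.101] -/
def flatGF : B8SectGH.GFData3 where
  Cfg := Unit
  Pert := BondField P
  GT := Site P 0 → ℝ
  Src := Site P 0 → ℝ
  k := P.K
  InA := fun α₀ _ => 0 < α₀
  Reg335 := fun α₀ _ => 0 < α₀
  InAAx := fun α₀ _ A' => A' = 0 ∧ 0 < α₀
  avgClose := fun α₁ _ A' => A' = 0 ∧ 0 < α₁
  avgClose166 := fun α₁ _ A' => A' = 0 ∧ 0 < α₁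
  Restricted := fun _ lam => InN P lam
  act := fun A' lam => A' + grad P lam
  C136 := fun B₁ _ s _ A =>
    (∀ μ x, |A μ x| < B₁ * s) ∧ ∀ μ ν x, |(B1RG242Torus.deriv P 0 P.eps μ *ᵥ A ν) x| < B₁ * s
  C137 := fun _ _ _ => True
  Landau := fun _ A => ProjEq P (div P A) 0
  C139 := fun _ _ _ _ => True
  C162 := fun B s _ A => ∀ μ x, |A μ x| < B * s
  fNorm := fun f => norm2 P f
  LandauF := fun _ f A => ProjEq P (div P A) f
  InAPair := fun _ _ _ => True
  fGrad := fun _ f => gradNorm3 P f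
  C140 := fun _ _ _ => True
  InR := fun _ f => InRange P f

variable {P}

/-! ## §3 No restricted chart gauge transformation solves (1.146) with the top-level ∇-bound, for the source `s·Δλ₀` -/

/-- **THE MECHANISM** (existence half of Theorem 8 in the model; our construction): on a torus of record with `d ≥ 2`,
`K ≥ 2`, for the source `f = Δ^ε_1(s·λ₀)` (`λ₀` of `B8Thm8TorusWitness`, `s > 0`) every `λ ∈ N(Q′_K)` ((1.29)) with
`R(1)D^{η*}D^η λ = f` ((1.146) for `U′ = 1`) IS `s·λ₀` (`eq_of_projEq`), whence `(∂^ε_1∂^ε_2 λ)(x₀) ≥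
s·((K − 1)·log L − 5/2)`; so the top-level ∇-member of (1.36) fails for every bound `B ≤ s·((K − 1)·log L − 5/2)`.
Neither (1.37), (1.39) nor the uniqueness clause of the theorem is used. [cite: Balaban1985RegularSpaces, Thm 8 p.101 + (1.36) p.82] -/
theorem no_restricted_landau_solution (hd : 2 ≤ P.d) (hK : 2 ≤ P.K) {B s : ℝ} (hs : 0 < s)
    (hB : B ≤ s * (((P.K - 1 : ℕ) : ℝ) * Real.log P.L - 5 / 2))
    (lam : Site P 0 → ℝ) (hR : InN P lam)
    (hLF : ProjEq P (div P (0 + grad P lam)) (H P 0 *ᵥ (s • lam0 P hd))) :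
    ¬ ∀ μ ν x, |(B1RG242Torus.deriv P 0 P.eps μ *ᵥ (0 + grad P lam) ν) x| < B := by
  intro h136
  rw [zero_add, div_grad] at hLF
  have hN0 : InN P (s • lam0 P hd) := by
    unfold InN
    rw [Matrix.mulVec_smul, Qk_lam0 hd (by omega), smul_zero]
  have heq : lam = s • lam0 P hd := eq_of_projEq hR hN0 hLF
  have h1 := h136 (dir0 P hd) (dir1 P hd) (ctr P hd)
  rw [zero_add, heq] at h1
  simp only [grad, Matrix.mulVec_smul, Pi.smul_apply, smul_eq_mul] at h1
  rw [abs_mul, abs_of_pos hs] at h1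
  have h2 := deriv_deriv_lam0_ctr P hd hK
  have h3 := le_abs_self ((B1RG242Torus.deriv P 0 P.eps (dir0 P hd) *ᵥ
    (B1RG242Torus.deriv P 0 P.eps (dir1 P hd) *ᵥ lam0 P hd)) (ctr P hd))
  nlinarith

/-! ## §4 Theorem 8 AS PRINTED fails for the flat abelian family -/

variable (P)

/-- **`¬ Thm8PrintedAt 1 B₁ B₂` FOR THE FLAT ABELIAN FAMILY** (every `B₁, B₂`; index `K ∈ ℕ` = number of RG steps,
`ε = L^{−K}`, same `d ≥ 2`, `L`, `m`: `B8Thm8TorusWitness.withK`).  Given the theorem's `c₁`, take `K` with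
`(K − 1)·log L − 5/2 > 4B₁`, `α₀ = α₁ = c₁/2`, `U₀ = 1`, `U′ = 1`, `f = Δ^ε_1(s·λ₀)` with `s = c₁/4`: all hypotheses hold
(`f ∈ R(1)`, `|f|₍₋₂₎ ≤ 2s = (α₀ + α₁)/2 < γ(α₀ + α₁)` with `γ = 1` since `|Δ^ε_1 λ₀| ≤ 2` and the weights are `≤ 1`), and
`no_restricted_landau_solution` refutes the existence clause (`B₁(α₀ + α₁) = 4B₁s < s·((K − 1)·log L − 5/2)`).  By
`B8SectGH.thm8PrintedAt_one_of_R` / `thm8PrintedAt_one_of_printed` the same holds for `Thm8PrintedR` and for r1's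
`B8.Thm8Printed` (`not_thm8PrintedR`, `not_thm8Printed`).  What this says about print: see the module docstring
(THE OBJECTION, HONEST SCOPE). [cite: Balaban1985RegularSpaces, Thm 8 p.101 + (1.36) p.82] -/
theorem not_thm8PrintedAt (hd : 2 ≤ P.d) (B₁ B₂ : ℝ) :
    ¬ B8SectGH.Thm8PrintedAt 1 B₁ B₂ (fun K : ℕ => flatGF (withK P K)) := by
  rintro ⟨c₁, hc₁, hT⟩
  have hL1 : (1 : ℝ) < P.L := by have := P.hL.2; exact_mod_cast this
  have hlog : 0 < Real.log P.L := Real.log_pos hL1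
  obtain ⟨n, hn⟩ := exists_nat_gt ((4 * B₁ + 5 / 2) / Real.log P.L)
  set K : ℕ := n + 2 with hKdef
  have hK2 : 2 ≤ (withK P K).K := by show 2 ≤ n + 2; omega
  have hrate : 4 * B₁ < (((withK P K).K - 1 : ℕ) : ℝ) * Real.log (withK P K).L - 5 / 2 := by
    have h3 : (((withK P K).K - 1 : ℕ) : ℝ) = n + 1 := by
      show (((n + 2 - 1 : ℕ) : ℝ)) = n + 1
      push_cast [show n + 2 - 1 = n + 1 by omega]
      ring
    have h6 : (withK P K).L = P.L := rfl
    rw [h3, h6]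
    have h4 : (4 * B₁ + 5 / 2) / Real.log P.L * Real.log P.L = 4 * B₁ + 5 / 2 := div_mul_cancel₀ _ hlog.ne'
    have h5 : (n : ℝ) * Real.log P.L > 4 * B₁ + 5 / 2 := by
      rw [← h4]; exact mul_lt_mul_of_pos_right hn hlog
    nlinarith
  have hc2 : 0 < c₁ / 2 := by positivity
  set s : ℝ := c₁ / 4 with hsdef
  have hs : 0 < s := by positivity
  set f : Site (withK P K) 0 → ℝ := H (withK P K) 0 *ᵥ (s • lam0 (withK P K) hd) with hfdef
  have hN0 : InN (withK P K) (s • lam0 (withK P K) hd) := by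
    unfold InN
    rw [Matrix.mulVec_smul, Qk_lam0 (P := withK P K) hd (by show 1 ≤ n + 2; omega), smul_zero]
  have hInR : InRange (withK P K) f := ⟨s • lam0 (withK P K) hd, hN0, rfl⟩
  have hnorm : norm2 (withK P K) f < 1 * (c₁ / 2 + c₁ / 2) := by
    have hle : norm2 (withK P K) f ≤ 2 * s := by
      apply norm2_le (by positivity)
      intro x
      rw [hfdef, Matrix.mulVec_smul, Pi.smul_apply, smul_eq_mul, abs_mul, abs_of_pos hs]
      have := abs_H_zero_lam0_le (withK P K) hd (by show 1 ≤ n + 2; omega) x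
      nlinarith
    rw [hsdef] at hle
    linarith
  -- specialise the packaged sentence to the index `K` and unfold the packaging
  have hT' := hT K (c₁ / 2) (c₁ / 2) hc2 hc2 (by linarith)
  dsimp only [flatGF] at hT'
  obtain ⟨lam, hR, ⟨⟨-, h136b⟩, -, -, hLF⟩, -⟩ := hT' () 0 f hc2 hc2 ⟨rfl, hc2⟩ ⟨rfl, hc2⟩ hInR hnorm
  have hB : B₁ * (c₁ / 2 + c₁ / 2) ≤ s * ((((withK P K).K - 1 : ℕ) : ℝ) * Real.log (withK P K).L - 5 / 2) := by
    rw [hsdef]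
    nlinarith
  exact no_restricted_landau_solution (P := withK P K) hd hK2 hs hB lam hR hLF h136b

/-- The literal ∀γ reading `Thm8PrintedR` fails too. [cite: Balaban1985RegularSpaces, Thm 8 p.101] -/
theorem not_thm8PrintedR (hd : 2 ≤ P.d) (B₁ B₂ : ℝ) :
    ¬ B8SectGH.Thm8PrintedR B₁ B₂ (fun K : ℕ => flatGF (withK P K)) :=
  fun h => not_thm8PrintedAt P hd B₁ B₂ (B8SectGH.thm8PrintedAt_one_of_R B₁ B₂ _ h)

/-- r1's typing `B8.Thm8Printed` (without the membership hypothesis) fails a fortiori. [cite: Balaban1985RegularSpaces, Thm 8 p.101] -/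
theorem not_thm8Printed (hd : 2 ≤ P.d) (B₁ B₂ : ℝ) :
    ¬ B8.Thm8Printed B₁ B₂ (fun K : ℕ => (flatGF (withK P K)).toGFData) :=
  fun h => not_thm8PrintedAt P hd B₁ B₂ (B8SectGH.thm8PrintedAt_one_of_printed B₁ B₂ _ h)

end Literature.MathematicalPhysics.QuantumFieldTheory.Balaban1983to89.B8Thm8FlatAbelianFamily
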